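import Summits.BirchSwinnertonDyer.Rank1Residual.Additive.X4SharpThreeKimRefined
import Summits.BirchSwinnertonDyer.Rank1Residual.X4.KimShaLength
import HarnessLib

/-!
# N11 — BRIDGES between the T-a2 shapes (Kurihara binder currency) and the cell's `∂^{(∞)}` vocabulary
# (`KuriharaNumberInvariants`, `X4.KimShaLength[RankZero]At`): the two channels cannot drift
# (cell `b2b-bsdres`, team n1011, seat p03, OWNERS row T-a2; THEOREMS ONLY; referee-1 RA3 spirit)

HONEST FRAMING (cell `b2b-bsdres`, run/shared/lean/b2b/bsd-rank1-residual/, verbatim in every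
file): the goal of the cell is to DELETE the COMBINATION-SHAPED residual classes of the
Birch–Swinnerton-Dyer formula for ALL analytic-rank `≤ 1` elliptic curves over `ℚ` — "full BSD
formula for every rank `≤ 1` curve in class `C`" assembled STRICTLY from published theorems — so
that the rank-`≤ 1` remainder becomes exactly the CONSTRUCTION-SHAPED classes, which are TYPED
(missing-input `Prop`s), NOT attempted. This is not "finishing BSD". Team n1011 (N10 / N11): prove
what is provable now; shrink each hard class to its core with data; no claim beyond stated classes.
Research routes; census output = EVIDENCE / conjecture items, never a Literature fact. The label X4
is UNCHANGED by this file; nothing is booked. Theorems only, fact-free (no Literature input at all):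
pure bookkeeping between two typings of the same objects.

## What this file proves

Two typers landed Kim's `∂`-calculus the same morning: cc-typer-1's VERBATIM channel
(`Literature/…/KuriharaNumberInvariants.lean`: `KuriharaDivisibleAt`, `kuriharaDivIndex`,
`kuriharaPartial` = `∂^{(i)}`, `kuriharaPartialInfty` = `∂^{(∞)}` as `ℕ∞`, cyclic levels;
`X4/KimShaLength.lean`: clause (6) verbatim `X4.KimShaLengthAt`, its rank-`0` reading
`X4.KimShaLengthRankZeroAt W p f` = "`∃ q d, L(E,1)/Ω = q ∧ ∂^{(∞)} = d ∧ ord_p q = ord_p #Ш(p) + d`")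
and this seat's BINDER channel (`Additive/X4SharpThreeKimRefined.lean`: the certificate predicate
`KuriharaIndexLeAt W p f m`, the directional shapes `KimRankZeroLowerBoundAt` /
`KimRankZeroUpperDivBoundAt`, Kim's refined conjecture `KimRefinedIndexLeAt/GeAt`). Here:

* §1 **`KuriharaIndexLeAt W p f m ⟺ kuriharaPartialInfty W p f ≤ m`** — the certificate predicate IS
  "`∂^{(∞)}(δ̃) ≤ m`" (`kuriharaIndexLeAt_iff_kuriharaPartialInfty_le`); and the universal
  divisibility premise of `KimRankZeroUpperDivBoundAt` (every `δ̃_n^{(k)}` divisible by `p^{min(m,k)}`,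
  literal `𝒩_k`) gives `m ≤ kuriharaPartialInfty` (`le_kuriharaPartialInfty_of_forall_dvd`).
* §2 **Kim's refined conjecture in both vocabularies**: `KimRefinedIndexLeAt W p` ⟺ (under its
  binders) `∂^{(∞)}(δ̃_{D.f}) ≤ ord_p ∏ c_ℓ`; `KimRefinedIndexGeAt W p` ⟹ `ord_p ∏ c_ℓ ≤ ∂^{(∞)}` — so
  T-a2's typed census conjecture (A0) reads `∂^{(∞)}(δ̃) = ord_p ∏_ℓ c_ℓ` in the `∂`-vocabulary, i.e.
  Kim's Conj. 1.10 / cc-typer-1's `bsdp_iff_eq_tamagawa_of_rankZero_witness` target.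
* §3 **The verbatim clause (6) implies both directional shapes**: if `X4.KimShaLengthRankZeroAt W p D.f`
  holds for every admissible datum `D`, then `KimRankZeroLowerBoundAt W p` and
  `KimRankZeroUpperDivBoundAt W p` (`kimRankZeroLowerBoundAt_of_kimShaLengthRankZeroAt`,
  `kimRankZeroUpperDivBoundAt_of_kimShaLengthRankZeroAt`) — this seat's shapes are COROLLARIES of the
  verbatim typing, never stronger.

References: C.-H. Kim, Amer. J. Math. 148 (2026) = arXiv:2203.12159v4 §1.5.1, Def. 2.13, Thm. 1.9 (6),
Conj. 1.10 [Kim2022StructureSelmer]; Miller 2011 Def. 1.1 [Miller2011LMS].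
-/

noncomputable section

open scoped Classical MatrixGroups ModularForm

open CongruenceSubgroup WeierstrassCurve Literature.NumberTheory.EllipticCurves
  Literature.NumberTheory.EllipticCurves.ModularForms
  Literature.NumberTheory.EllipticCurves.Rank1Residual
  Literature.NumberTheory.EllipticCurves.Rank1Residual.Typed

namespace Summit.BirchSwinnertonDyer.Rank1Residual.Additive

variable (W : WeierstrassCurve ℚ) [W.IsElliptic] [W.IsGloballyMinimal] (p : ℕ) [Fact p.Prime]

/-! ## §1 The certificate predicate is `∂^{(∞)} ≤ m`; universal divisibility is `m ≤ ∂^{(∞)}` -/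

omit [W.IsElliptic] [Fact p.Prime] in
/-- A Kurihara number `δ̃_n^{(k)} ≠ 0` (some surjective `ψ`) bounds the divisibility index of `δ̃_n`
by `k − 1`: `δ̃_n ∉ p^k(ℤ_p/I_n)`. [cite: Kim2022StructureSelmer, §1.5.1 (PDF p. 7), Def. 2.13] -/
theorem kuriharaDivIndex_le_of_ne_zero {N : ℕ} [NeZero N] (f : CuspForm (Gamma0 N) 2) {k n : ℕ}
    [NeZero n] (hn : Kato.IsKolyvaginProduct W p k n)
    (ψ : (ℓ : ℕ) → (ZMod ℓ)ˣ →* Multiplicative (ZMod (p ^ k)))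
    (hψ : ∀ ℓ ∈ n.primeFactors, Function.Surjective (ψ ℓ)) (hδ : kuriharaNumber f (p ^ k) n ψ ≠ 0) :
    kuriharaDivIndex W p f n ≤ ((k - 1 : ℕ) : ℕ∞) := by
  rw [kuriharaDivIndex_def]
  refine iSup₂_le fun j hj => ?_
  by_contra hlt
  have hkj : k ≤ j := by
    have : ¬ ((j : ℕ∞) ≤ ((k - 1 : ℕ) : ℕ∞)) := hlt
    rw [ENat.coe_le_coe] at this
    omega
  exact hδ (hj k hkj hn ψ hψ)

omit [W.IsElliptic] [Fact p.Prime] in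
/-- **`KuriharaIndexLeAt ⟹ ∂^{(∞)} ≤ m`**: a witness (level `k ≤ m + 1`, cyclic `n ∈ 𝒩_k`, `ψ`,
`δ̃_n^{(k)} ≠ 0`) bounds `∂^{(ν(n))}` and hence `∂^{(∞)}`. [cite: Kim2022StructureSelmer, §1.5.1 (PDF p. 7)] -/
theorem kuriharaPartialInfty_le_of_kuriharaIndexLeAt {N : ℕ} [NeZero N] (f : CuspForm (Gamma0 N) 2)
    {m : ℕ} (h : KuriharaIndexLeAt W p f m) : kuriharaPartialInfty W p f ≤ (m : ℕ∞) := by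
  obtain ⟨k, n, hn0, hk1, hkm, hn, hcyc, ψ, hψ, hδ⟩ := h
  have hcl : IsCyclicKolyvaginLevel W p n := ⟨hn.mono hk1, hcyc⟩
  calc kuriharaPartialInfty W p f ≤ kuriharaPartial W p f n.primeFactors.card :=
        kuriharaPartialInfty_le W p f _
    _ ≤ kuriharaDivIndex W p f n := kuriharaPartial_le W p f hcl rfl
    _ ≤ ((k - 1 : ℕ) : ℕ∞) := kuriharaDivIndex_le_of_ne_zero W p f hn ψ hψ hδ
    _ ≤ (m : ℕ∞) := by exact_mod_cast (by omega : k - 1 ≤ m)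

omit [W.IsElliptic] [Fact p.Prime] in
/-- **`∂^{(∞)} ≤ m ⟹ KuriharaIndexLeAt`** (no attainment needed: if NO cyclic level carried a
Kurihara number non-zero mod `p^k` with `k ≤ m + 1`, every cyclic `δ̃_n` would be divisible by
`p^{m+1}` and `∂^{(∞)} ≥ m + 1`). [cite: Kim2022StructureSelmer, §1.5.1 (PDF p. 7), Def. 2.13] -/
theorem kuriharaIndexLeAt_of_kuriharaPartialInfty_le {N : ℕ} [NeZero N] (f : CuspForm (Gamma0 N) 2)
    {m : ℕ} (h : kuriharaPartialInfty W p f ≤ (m : ℕ∞)) : KuriharaIndexLeAt W p f m := by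
  by_contra hno
  -- every cyclic level is divisible by `p^{m+1}`
  have hdiv : ∀ n : ℕ, IsCyclicKolyvaginLevel W p n → KuriharaDivisibleAt W p f n (m + 1) := by
    intro n hn k hk hkn ψ hψ
    haveI : NeZero n := ⟨hkn.ne_zero⟩
    by_contra hne
    rcases Nat.eq_zero_or_pos k with rfl | hk0
    · haveI : Subsingleton (ZMod (p ^ 0)) := ZMod.subsingleton_iff.mpr (pow_zero p)
      exact hne (Subsingleton.elim _ _)
    · exact hno ⟨k, n, inferInstance, hk0, hk, hkn, hn.2, ψ, hψ, hne⟩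
  have hge : ((m + 1 : ℕ) : ℕ∞) ≤ kuriharaPartialInfty W p f := by
    refine le_iInf fun i => ?_
    rw [kuriharaPartial_def]
    exact le_iInf fun n => le_iInf fun hn => le_iInf fun _ =>
      le_kuriharaDivIndex_of_divisibleAt W p f (hdiv n hn)
  have : ((m + 1 : ℕ) : ℕ∞) ≤ (m : ℕ∞) := hge.trans h
  rw [ENat.coe_le_coe] at this
  omega

omit [W.IsElliptic] [Fact p.Prime] in
/-- **The certificate predicate IS `∂^{(∞)}(δ̃) ≤ m`.** [cite: Kim2022StructureSelmer, §1.5.1 (PDF p. 7)] -/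
theorem kuriharaIndexLeAt_iff_kuriharaPartialInfty_le {N : ℕ} [NeZero N] (f : CuspForm (Gamma0 N) 2)
    (m : ℕ) : KuriharaIndexLeAt W p f m ↔ kuriharaPartialInfty W p f ≤ (m : ℕ∞) :=
  ⟨kuriharaPartialInfty_le_of_kuriharaIndexLeAt W p f, kuriharaIndexLeAt_of_kuriharaPartialInfty_le W p f⟩

omit [W.IsElliptic] [Fact p.Prime] in
/-- **Universal divisibility ⟹ `m ≤ ∂^{(∞)}`**: if every Kurihara number at every level `n ∈ 𝒩_k`
(`1 ≤ k`, literal `𝒩_k`, every surjective `ψ`) is divisible by `p^{min(m,k)}` in `ℤ/p^k` — the premise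
of `KimRankZeroUpperDivBoundAt` at `m` / the conclusion of `KimRefinedIndexGeAt` — then every
`δ̃_n ∈ p^m(ℤ_p/I_n)` and `m ≤ ∂^{(∞)}(δ̃)` (cyclic levels a fortiori).
[cite: Kim2022StructureSelmer, §1.5.1 (PDF p. 7), Def. 2.13 (PDF p. 14)] -/
theorem le_kuriharaPartialInfty_of_forall_dvd {N : ℕ} [NeZero N] (f : CuspForm (Gamma0 N) 2) {m : ℕ}
    (h : ∀ (k n : ℕ) [NeZero n], 1 ≤ k → Kato.IsKolyvaginProduct W p k n →
      ∀ ψ : (ℓ : ℕ) → (ZMod ℓ)ˣ →* Multiplicative (ZMod (p ^ k)),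
        (∀ ℓ ∈ n.primeFactors, Function.Surjective (ψ ℓ)) →
        ((p ^ min m k : ℕ) : ZMod (p ^ k)) ∣ kuriharaNumber f (p ^ k) n ψ) :
    (m : ℕ∞) ≤ kuriharaPartialInfty W p f := by
  have hdiv : ∀ n : ℕ, KuriharaDivisibleAt W p f n m := by
    intro n k hk hkn ψ hψ
    haveI : NeZero n := ⟨hkn.ne_zero⟩
    rcases Nat.eq_zero_or_pos k with rfl | hk0
    · haveI : Subsingleton (ZMod (p ^ 0)) := ZMod.subsingleton_iff.mpr (pow_zero p)
      exact Subsingleton.elim _ _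
    · have hd := h k n hk0 hkn ψ hψ
      rw [min_eq_right hk, ZMod.natCast_self, zero_dvd_iff] at hd
      exact hd
  refine le_iInf fun i => ?_
  rw [kuriharaPartial_def]
  exact le_iInf fun n => le_iInf fun _ => le_iInf fun _ =>
    le_kuriharaDivIndex_of_divisibleAt W p f (hdiv n)

/-! ## §2 Kim's refined conjecture at the pair, in the `∂`-vocabulary -/

/-- **`KimRefinedIndexLeAt W p` ⟺ "`∂^{(∞)}(δ̃_{D.f}) ≤ ord_p ∏_ℓ c_ℓ(E)` under its binders"** — the
`≤` half of Kim's Conj. 1.10 at the pair, `c_p` included. [cite: Kim2022StructureSelmer, Conj. 1.10 (PDF p. 8), §1.5.1] -/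
theorem kimRefinedIndexLeAt_iff_partialInfty_le :
    KimRefinedIndexLeAt W p ↔
      (W.HasSurjectiveModNGaloisRep p → (∀ n : ℕ, W.HasSurjectiveModNGaloisRep (p ^ n : ℕ)) →
        W.entireLFunction 1 ≠ 0 →
        ∀ {N : ℕ} [NeZero N] (D : ModularParametrizationData W N), ¬ (p : ℤ) ∣ D.maninConstant →
        (∃ u : ℚ, ‖(u : ℚ_[p])‖ = 1 ∧ W.realPeriodRat = u * plusPeriod D.f) →
        kuriharaPartialInfty W p D.f ≤ (padicValNat p W.tamagawaProduct : ℕ∞)) := by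
  constructor
  · intro h hs ht hL N _ D hc hper
    exact kuriharaPartialInfty_le_of_kuriharaIndexLeAt W p D.f (h hs ht hL D hc hper)
  · intro h hs ht hL N _ D hc hper
    exact kuriharaIndexLeAt_of_kuriharaPartialInfty_le W p D.f (h hs ht hL D hc hper)

/-- **`KimRefinedIndexGeAt W p` ⟹ "`ord_p ∏_ℓ c_ℓ(E) ≤ ∂^{(∞)}(δ̃_{D.f})` under its binders"** — the
`≥` half of Kim's Conj. 1.10 at the pair (cyclic-level `∂`; the typed premise covers all levels).
[cite: Kim2022StructureSelmer, Conj. 1.10 (PDF p. 8), §1.5.1] -/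
theorem le_partialInfty_of_kimRefinedIndexGeAt (h : KimRefinedIndexGeAt W p)
    (hs : W.HasSurjectiveModNGaloisRep p) (ht : ∀ n : ℕ, W.HasSurjectiveModNGaloisRep (p ^ n : ℕ))
    (hL : W.entireLFunction 1 ≠ 0)
    {N : ℕ} [NeZero N] (D : ModularParametrizationData W N) (hc : ¬ (p : ℤ) ∣ D.maninConstant)
    (hper : ∃ u : ℚ, ‖(u : ℚ_[p])‖ = 1 ∧ W.realPeriodRat = u * plusPeriod D.f) :
    (padicValNat p W.tamagawaProduct : ℕ∞) ≤ kuriharaPartialInfty W p D.f :=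
  le_kuriharaPartialInfty_of_forall_dvd W p D.f fun k n _ hk hn ψ hψ => h hs ht hL D hc hper k n hk hn ψ hψ

/-- **T-a2's census conjecture (A0) in the `∂`-vocabulary**: `KimRefinedIndexLeAt ∧ KimRefinedIndexGeAt`
at the pair gives, for every admissible datum, `∂^{(∞)}(δ̃_{D.f}) = ord_p ∏_ℓ c_ℓ(E)` — Kim's
Conj. 1.10 verbatim (cyclic-level `∂`, `c_p` included), the `d = ord_p ∏ c_ℓ` of cc-typer-1's
`X4.bsdp_iff_eq_tamagawa_of_rankZero_witness`. [cite: Kim2022StructureSelmer, Conj. 1.10 (PDF p. 8)] -/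
theorem partialInfty_eq_tamagawa_of_kimRefined (hle : KimRefinedIndexLeAt W p)
    (hge : KimRefinedIndexGeAt W p)
    (hs : W.HasSurjectiveModNGaloisRep p) (ht : ∀ n : ℕ, W.HasSurjectiveModNGaloisRep (p ^ n : ℕ))
    (hL : W.entireLFunction 1 ≠ 0)
    {N : ℕ} [NeZero N] (D : ModularParametrizationData W N) (hc : ¬ (p : ℤ) ∣ D.maninConstant)
    (hper : ∃ u : ℚ, ‖(u : ℚ_[p])‖ = 1 ∧ W.realPeriodRat = u * plusPeriod D.f) :
    kuriharaPartialInfty W p D.f = (padicValNat p W.tamagawaProduct : ℕ∞) :=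
  le_antisymm ((kimRefinedIndexLeAt_iff_partialInfty_le W p).mp hle hs ht hL D hc hper)
    (le_partialInfty_of_kimRefinedIndexGeAt W p hge hs ht hL D hc hper)

/-! ## §3 The verbatim clause (6) (`X4.KimShaLengthRankZeroAt`) implies both directional shapes -/

/-- **Verbatim (6) ⟹ the LOWER shape.** If cc-typer-1's rank-`0` reading of clause (6)
`X4.KimShaLengthRankZeroAt W p D.f` (`∃ q d, L/Ω = q ∧ ∂^{(∞)} = d ∧ ord_p q = ord_p #Ш(p) + d`) holds
for every datum `D` with `p ∤ c_D` and the period transfer (under `ρ̄` onto, tower, `L(E,1) ≠ 0`,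
`Ш` finite), then `KimRankZeroLowerBoundAt W p`: a witness `δ̃_n^{(k)} ≠ 0` at a cyclic level gives
`d = ∂^{(∞)} ≤ k − 1`. This seat's LOWER shape is a COROLLARY of the verbatim typing.
[cite: Kim2022StructureSelmer, Thm. 1.9 (6) (PDF p. 8), §1.5.1] -/
theorem kimRankZeroLowerBoundAt_of_kimShaLengthRankZeroAt
    (h : W.HasSurjectiveModNGaloisRep p → (∀ n : ℕ, W.HasSurjectiveModNGaloisRep (p ^ n : ℕ)) →
      W.entireLFunction 1 ≠ 0 → Finite W.sha →
      ∀ {N : ℕ} [NeZero N] (D : ModularParametrizationData W N), ¬ (p : ℤ) ∣ D.maninConstant →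
      (∃ u : ℚ, ‖(u : ℚ_[p])‖ = 1 ∧ W.realPeriodRat = u * plusPeriod D.f) →
      X4.KimShaLengthRankZeroAt W p D.f) :
    KimRankZeroLowerBoundAt W p := by
  intro hs ht hL hfin N _ D hc hper k n _ hk hn hcyc ψ hψ hδ
  obtain ⟨q, d, hq, hd, hv⟩ := h hs ht hL hfin D hc hper
  refine ⟨q, hq, ?_⟩
  have hidx : KuriharaIndexLeAt W p D.f (k - 1) :=
    ⟨k, n, inferInstance, hk, by omega, hn, hcyc, ψ, hψ, hδ⟩
  have hdk : (d : ℕ∞) ≤ ((k - 1 : ℕ) : ℕ∞) :=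
    hd ▸ kuriharaPartialInfty_le_of_kuriharaIndexLeAt W p D.f hidx
  rw [ENat.coe_le_coe] at hdk
  rw [hv]
  have : (d : ℤ) ≤ ((k - 1 : ℕ) : ℤ) := by exact_mod_cast hdk
  linarith

/-- **Verbatim (6) ⟹ the UPPER-divisibility shape.** Same hypothesis; the universal divisibility
premise at `m` gives `m ≤ ∂^{(∞)} = d`, hence `ord_p #Ш(p) + m ≤ ord_p #Ш(p) + d = ord_p q`.
[cite: Kim2022StructureSelmer, Thm. 1.9 (6) (PDF p. 8), §1.5.1] -/
theorem kimRankZeroUpperDivBoundAt_of_kimShaLengthRankZeroAt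
    (h : W.HasSurjectiveModNGaloisRep p → (∀ n : ℕ, W.HasSurjectiveModNGaloisRep (p ^ n : ℕ)) →
      W.entireLFunction 1 ≠ 0 → Finite W.sha →
      ∀ {N : ℕ} [NeZero N] (D : ModularParametrizationData W N), ¬ (p : ℤ) ∣ D.maninConstant →
      (∃ u : ℚ, ‖(u : ℚ_[p])‖ = 1 ∧ W.realPeriodRat = u * plusPeriod D.f) →
      X4.KimShaLengthRankZeroAt W p D.f) :
    KimRankZeroUpperDivBoundAt W p := by
  intro hs ht hL hfin N _ D hc hper m hdvd
  obtain ⟨q, d, hq, hd, hv⟩ := h hs ht hL hfin D hc hper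
  refine ⟨q, hq, ?_⟩
  have hmd : (m : ℕ∞) ≤ (d : ℕ∞) :=
    hd ▸ le_kuriharaPartialInfty_of_forall_dvd W p D.f fun k n _ hk hn ψ hψ => hdvd k n hk hn ψ hψ
  rw [ENat.coe_le_coe] at hmd
  rw [hv]
  have : (m : ℤ) ≤ (d : ℤ) := by exact_mod_cast hmd
  linarith

end Summit.BirchSwinnertonDyer.Rank1Residual.Additive

end
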